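import Summits.QuantumFields.YangMills.Theorems.AllWindowsColdBoxBulkMidSandwichLocalisedRemainder

/-!
# The localised second moment of the affine score, and the bookkeeping algebra of the localised ceiling
# (crux idea `logconcave-core-extension` on ⟨stmt-QuantumFields-24006⟩ — toward a LOCALISED quadratic
# covariance comparison at the core constant `r_K`)

Whitened frame, `A ∈ C²(ℝⁿ)`, global sandwich `(1 ± δ)` (`0 ≤ δ < 1`), core `K` with Hessian pinching
`(1 ± δ_K)`, centring; `Z = ∫e^{−A}`, `P = ∫_{Kᶜ}e^{−A}`, `u = Hx + b`.

* `score_sq_le_localised` : `∫(∂_uA − trH)²e^{−A} ≤ tr(H²)Z + (1+δ_K)(∫|Hx|²e^{−A} + |b|²Z) + (δ−δ_K)∫_{Kᶜ}|u|²e^{−A}`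
  (the exact `integral_score_sq` plus the localised Hessian integral);
* `inv_one_sub_sub_inv_one_sub_le` : `(1−δ)⁻¹ − (1−δ_K)⁻¹ ≤ 4δ` (the bound `(1−x)⁻¹ ≤ 1 + 2x` on `[0,½]` is
  inlined; it is the tree's `Literature.Computability.AlgebraicComplexity.SlidingWindow.inv_one_sub_le`);
* `score_algebra_localised`, `remainder_algebra_localised`, `ceiling_algebra_localised` : the pure-real
  bookkeeping that turns the localised inputs into `(1 + C·ρ)·rV`, `ρ = δ_K + δ·(P/Z)^{1/4}`.

HONEST SCOPE.  Free-hands work of the LEAD seat of ⟨stmt-QuantumFields-24006⟩ (FCL lineage) on an ingredient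
of an UN-TRIAGED crux idea card; classical log-concave probability.  No stub of LINE-18, no crux, rung or
summit is proved; the Yang–Mills mass gap is NOT proved by any of this.
-/

noncomputable section

namespace Summit.QuantumFields.YangMills.Theorems.SandwichVariancePinching

open MeasureTheory Real Filter Topology Set
open Summit.QuantumFields.YangMills.Cruxes.TransportCovarianceTransfer (dotProduct_mulVec_of_isSymm)

variable {n : ℕ}

/-! ## §1 The localised second moment of the score -/

/-- Centred expansion `∫ |Hx+b|² e^{−A} = ∫ |Hx|² e^{−A} + |b|²·∫e^{−A}` (`H` symmetric, `∫x_i e^{−A} = 0`).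
[folklore] -/
theorem integral_affine_normSq_eq {A : (Fin n → ℝ) → ℝ} (hA : ContDiff ℝ 2 A) {δ : ℝ} (hδ1 : δ < 1)
    (hsw : ∀ x h : Fin n → ℝ, (1 - δ) * (h ⬝ᵥ h) ≤ A (x + h) + A (x - h) - 2 * A x ∧
      A (x + h) + A (x - h) - 2 * A x ≤ (1 + δ) * (h ⬝ᵥ h))
    (hcent : ∀ i : Fin n, ∫ x, x i * exp (-A x) = 0)
    {H : Matrix (Fin n) (Fin n) ℝ} (hH : H.IsSymm) (b : Fin n → ℝ) :
    ∫ x, ((H.mulVec x + b) ⬝ᵥ (H.mulVec x + b)) * exp (-A x) =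
      (∫ x, (H.mulVec x ⬝ᵥ H.mulVec x) * exp (-A x)) + (b ⬝ᵥ b) * ∫ x, exp (-A x) := by
  have hAc : Continuous A := hA.continuous
  obtain ⟨C₀, κ, _, hκ, hlb⟩ := exists_quadratic_lower_of_sandwich hAc hδ1 hsw
  have hZint : Integrable fun x => exp (-A x) := by
    have := integrable_mul_exp_neg_of_growth hAc continuous_const hκ (by norm_num : 0 ≤ 8) hlb
      (w := fun _ => (1:ℝ)) (D := 1) (fun x => by simp)
    simpa using this
  obtain ⟨CH, hCH0, hCH⟩ := exists_norm_affine_le H 0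
  have hn : (0:ℝ) ≤ n := Nat.cast_nonneg n
  have hIS2 : Integrable fun x => (H.mulVec x ⬝ᵥ H.mulVec x) * exp (-A x) := by
    refine integrable_mul_exp_neg_of_growth hAc ((continuous_const.matrix_mulVec continuous_id).dotProduct
      (continuous_const.matrix_mulVec continuous_id)) hκ (by norm_num : 2 ≤ 8) hlb (D := (n : ℝ) * CH ^ 2) fun x => ?_
    rw [abs_of_nonneg (by simpa using dotProduct_self_star_nonneg (H.mulVec x))]
    have h2 : ‖H.mulVec x‖ ≤ CH * (1 + ‖x‖) := by simpa using hCH x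
    have h3 : ‖H.mulVec x‖ ^ 2 ≤ CH ^ 2 * (1 + ‖x‖) ^ 2 := by
      rw [← mul_pow]; exact pow_le_pow_left₀ (norm_nonneg _) h2 2
    nlinarith [dotProduct_self_le_card_mul_norm_sq (H.mulVec x), mul_le_mul_of_nonneg_left h3 hn]
  have hIlin : ∀ w : Fin n → ℝ, Integrable fun x => (w ⬝ᵥ x) * exp (-A x) := fun w =>
    integrable_mul_exp_neg_of_growth hAc (continuous_const.dotProduct continuous_id) hκ
      (by norm_num : 1 ≤ 8) hlb (abs_dotProduct_le_growth w)
  have hlin0 : ∀ w : Fin n → ℝ, ∫ x, (w ⬝ᵥ x) * exp (-A x) = 0 :=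
    integral_dotProduct_mul_exp_neg_eq_zero hAc hδ1 hsw hcent
  have e : (fun x => ((H.mulVec x + b) ⬝ᵥ (H.mulVec x + b)) * exp (-A x)) = fun x =>
      (H.mulVec x ⬝ᵥ H.mulVec x) * exp (-A x) + (((2:ℝ) • H.mulVec b) ⬝ᵥ x) * exp (-A x) +
        (b ⬝ᵥ b) * exp (-A x) := by
    funext x
    have e1 : H.mulVec x ⬝ᵥ b = H.mulVec b ⬝ᵥ x := by
      rw [← dotProduct_mulVec_of_isSymm hH x b, dotProduct_comm]
    have e2 : b ⬝ᵥ H.mulVec x = H.mulVec b ⬝ᵥ x := dotProduct_mulVec_of_isSymm hH b x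
    simp only [add_dotProduct, dotProduct_add, smul_dotProduct, smul_eq_mul, e1, e2]
    ring
  have hI1 : Integrable fun x => (H.mulVec x ⬝ᵥ H.mulVec x) * exp (-A x) +
      (((2:ℝ) • H.mulVec b) ⬝ᵥ x) * exp (-A x) := hIS2.add (hIlin _)
  rw [e, integral_add hI1 (hZint.const_mul _), integral_add hIS2 (hIlin _), integral_const_mul, hlin0]
  ring

/-- **LOCALISED SCORE SECOND MOMENT**:
`∫ (∂_{Hx+b}A − trH)² e^{−A} ≤ tr(H²)Z + (1+δ_K)(∫|Hx|²e^{−A} + |b|²Z) + (δ−δ_K)∫_{Kᶜ}|Hx+b|²e^{−A}`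
for a centred sandwiched `C²` potential with the local Hessian ceiling `(1+δ_K)` on `K`. [folklore] -/
theorem score_sq_le_localised {A : (Fin n → ℝ) → ℝ} (hA : ContDiff ℝ 2 A) {δ : ℝ} (hδ : 0 ≤ δ) (hδ1 : δ < 1)
    (hsw : ∀ x h : Fin n → ℝ, (1 - δ) * (h ⬝ᵥ h) ≤ A (x + h) + A (x - h) - 2 * A x ∧
      A (x + h) + A (x - h) - 2 * A x ≤ (1 + δ) * (h ⬝ᵥ h))
    (hcent : ∀ i : Fin n, ∫ x, x i * exp (-A x) = 0)
    {K : Set (Fin n → ℝ)} (hK : MeasurableSet K) {δK : ℝ}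
    (hloc : ∀ x ∈ K, ∀ v : Fin n → ℝ, fderiv ℝ (fderiv ℝ A) x v v ≤ (1 + δK) * (v ⬝ᵥ v))
    {H : Matrix (Fin n) (Fin n) ℝ} (hH : H.IsSymm) (b : Fin n → ℝ) :
    ∫ x, (fderiv ℝ A x (H.mulVec x + b) - H.trace) ^ 2 * exp (-A x) ≤
      (H * H).trace * (∫ x, exp (-A x)) +
        (1 + δK) * ((∫ x, (H.mulVec x ⬝ᵥ H.mulVec x) * exp (-A x)) + (b ⬝ᵥ b) * ∫ x, exp (-A x)) +
        (δ - δK) * ∫ x in Kᶜ, ((H.mulVec x + b) ⬝ᵥ (H.mulVec x + b)) * exp (-A x) := by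
  have hG2 := integral_score_sq hA hδ hδ1 hsw H b
  have hHess := integral_hess_affine_le_localised hA hδ hδ1 hsw hK hloc H b
  have hIuu := integral_affine_normSq_eq hA hδ1 hsw hcent hH b
  rw [hG2, ← hIuu]
  linarith

/-! ## §2 Elementary bounds on the Brascamp–Lieb constants -/

/-- `(1−δ)⁻¹ − (1−δ_K)⁻¹ ≤ 4δ` for `0 ≤ δ_K ≤ δ ≤ ½` (indeed `= (δ−δ_K)/((1−δ)(1−δ_K))`). [folklore] -/
theorem inv_one_sub_sub_inv_one_sub_le {δ δK : ℝ} (hδ2 : δ ≤ 1 / 2) (hδK : 0 ≤ δK)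
    (hδKδ : δK ≤ δ) : (1 - δ)⁻¹ - (1 - δK)⁻¹ ≤ 4 * δ := by
  have h1 : 0 < 1 - δ := by linarith
  have h2 : 0 < 1 - δK := by linarith
  rw [inv_eq_one_div, inv_eq_one_div, div_sub_div _ _ h1.ne' h2.ne', div_le_iff₀ (mul_pos h1 h2)]
  nlinarith [mul_nonneg hδK (by linarith : (0:ℝ) ≤ δ)]

/-! ## §3 The bookkeeping algebra of the localised ceiling -/

/-- **SCORE BOOKKEEPING**: with `ρ = δ_K + δ s` (`s = (P/Z)^{1/4} ∈ [0,1]`), the localised inputs give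
`∫G² ≤ (1 + 24ρ)·(2τ + β)·Z`. [folklore] -/
theorem score_algebra_localised {τ β Z S₂ Xoff G2 δ δK s : ℝ} (hτ : 0 ≤ τ) (hβ : 0 ≤ β) (hZ : 0 ≤ Z)
    (hδ : 0 ≤ δ) (hδ2 : δ ≤ 1 / 2) (hδK : 0 ≤ δK) (hδKδ : δK ≤ δ) (hs0 : 0 ≤ s) (hs1 : s ≤ 1)
    (hXoff0 : 0 ≤ Xoff)
    (hS2 : S₂ ≤ τ * ((1 - δK)⁻¹ * (Z - s ^ 4 * Z) + (1 - δ)⁻¹ * (s ^ 4 * Z)))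
    (hX : Xoff ≤ 14 * (τ / (1 - δ) + β) * (Z * s ^ 2))
    (hG : G2 ≤ τ * Z + (1 + δK) * (S₂ + β * Z) + (δ - δK) * Xoff) :
    G2 ≤ (1 + 24 * (δK + δ * s)) * (2 * τ + β) * Z := by
  have haK : (1 - δK)⁻¹ ≤ 1 + 2 * δK := by
    have hx2 : δK ≤ 1 / 2 := hδKδ.trans hδ2
    rw [inv_le_comm₀ (by linarith) (by linarith)]
    have h : (1 + 2 * δK)⁻¹ * (1 + 2 * δK) = 1 := inv_mul_cancel₀ (by linarith)
    nlinarith [inv_nonneg.mpr (by linarith : (0:ℝ) ≤ 1 + 2 * δK)]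
  have ha : (1 - δ)⁻¹ ≤ 1 + 2 * δ := by
    rw [inv_le_comm₀ (by linarith) (by linarith)]
    have h : (1 + 2 * δ)⁻¹ * (1 + 2 * δ) = 1 := inv_mul_cancel₀ (by linarith)
    nlinarith [inv_nonneg.mpr (by linarith : (0:ℝ) ≤ 1 + 2 * δ)]
  have hdiff := inv_one_sub_sub_inv_one_sub_le hδ2 hδK hδKδ
  have hs4 : s ^ 4 ≤ s := by
    have : s ^ 4 ≤ s ^ 1 := pow_le_pow_of_le_one hs0 hs1 (by norm_num)
    simpa using this
  have hs2 : s ^ 2 ≤ s := by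
    have : s ^ 2 ≤ s ^ 1 := pow_le_pow_of_le_one hs0 hs1 (by norm_num)
    simpa using this
  have hs40 : 0 ≤ s ^ 4 := by positivity
  have hτZ : 0 ≤ τ * Z := mul_nonneg hτ hZ
  have hβZ : 0 ≤ β * Z := mul_nonneg hβ hZ
  set rZ : ℝ := (2 * τ + β) * Z with hrZ
  have hrZ0 : 0 ≤ rZ := by rw [hrZ]; positivity
  have hτr : τ * Z ≤ rZ := by rw [hrZ]; nlinarith only [hτ, hβ, hZ]
  have hβr : β * Z ≤ rZ := by rw [hrZ]; nlinarith only [hτ, hβ, hZ]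
  set ρ : ℝ := δK + δ * s with hρ
  have hρ0 : 0 ≤ ρ := by rw [hρ]; positivity
  have hρ1 : ρ ≤ 1 := by rw [hρ]; nlinarith only [hδKδ, hδ2, hs1, hδ, hs0]
  have hδKρ : δK ≤ ρ := by rw [hρ]; nlinarith only [hδ, hs0]
  have hδsρ : δ * s ≤ ρ := by rw [hρ]; linarith
  -- `S₂ ≤ τ Z (1 + 2δK + 4δ s)`
  have hcoef : (1 - δK)⁻¹ + ((1 - δ)⁻¹ - (1 - δK)⁻¹) * s ^ 4 ≤ 1 + 2 * δK + 4 * δ * s := by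
    have h1 : ((1 - δ)⁻¹ - (1 - δK)⁻¹) * s ^ 4 ≤ 4 * δ * s ^ 4 := mul_le_mul_of_nonneg_right hdiff hs40
    have h2 : 4 * δ * s ^ 4 ≤ 4 * δ * s := mul_le_mul_of_nonneg_left hs4 (by linarith)
    linarith
  have hS2' : S₂ ≤ τ * Z * (1 + 2 * δK + 4 * δ * s) := by
    have e : τ * ((1 - δK)⁻¹ * (Z - s ^ 4 * Z) + (1 - δ)⁻¹ * (s ^ 4 * Z)) =
        τ * Z * ((1 - δK)⁻¹ + ((1 - δ)⁻¹ - (1 - δK)⁻¹) * s ^ 4) := by ring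
    rw [e] at hS2
    exact hS2.trans (mul_le_mul_of_nonneg_left hcoef hτZ)
  -- `Xoff ≤ 14 rZ s²`
  have hX' : Xoff ≤ 14 * rZ * s ^ 2 := by
    have h1 : τ / (1 - δ) + β ≤ 2 * τ + β := by
      rw [div_eq_mul_inv]; nlinarith only [mul_le_mul_of_nonneg_left ha hτ, hτ, hδ, hδ2]
    have := mul_le_mul_of_nonneg_right (mul_le_mul_of_nonneg_left h1 (by norm_num : (0:ℝ) ≤ 14))
      (by positivity : 0 ≤ Z * s ^ 2)
    rw [hrZ]; linarith
  -- the four extra terms, each `≤ c·ρ·rZ`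
  have hb1 : τ * Z * (2 * δK + 4 * δ * s) ≤ 4 * ρ * rZ := by
    have h1 : 2 * δK + 4 * δ * s ≤ 4 * ρ := by linarith
    calc τ * Z * (2 * δK + 4 * δ * s) ≤ τ * Z * (4 * ρ) := mul_le_mul_of_nonneg_left h1 hτZ
      _ ≤ rZ * (4 * ρ) := mul_le_mul_of_nonneg_right hτr (by positivity)
      _ = 4 * ρ * rZ := by ring
  have hb2 : δK * (τ * Z * (1 + 2 * δK + 4 * δ * s)) ≤ 5 * ρ * rZ := by
    have h1 : 1 + 2 * δK + 4 * δ * s ≤ 5 := by linarith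
    calc δK * (τ * Z * (1 + 2 * δK + 4 * δ * s)) ≤ δK * (τ * Z * 5) :=
          mul_le_mul_of_nonneg_left (mul_le_mul_of_nonneg_left h1 hτZ) hδK
      _ ≤ ρ * (rZ * 5) := mul_le_mul hδKρ (mul_le_mul_of_nonneg_right hτr (by norm_num)) (by positivity) hρ0
      _ = 5 * ρ * rZ := by ring
  have hb3 : δK * (β * Z) ≤ ρ * rZ := mul_le_mul hδKρ hβr hβZ hρ0
  have hb4 : δ * (14 * rZ * s ^ 2) ≤ 14 * ρ * rZ := by
    calc δ * (14 * rZ * s ^ 2) ≤ δ * (14 * rZ * s) :=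
          mul_le_mul_of_nonneg_left (mul_le_mul_of_nonneg_left hs2 (by positivity)) hδ
      _ = 14 * (δ * s) * rZ := by ring
      _ ≤ 14 * ρ * rZ := by nlinarith only [hδsρ, hrZ0]
  have hA1 : (1 + δK) * (S₂ + β * Z) ≤ τ * Z + β * Z + τ * Z * (2 * δK + 4 * δ * s) +
      δK * (τ * Z * (1 + 2 * δK + 4 * δ * s)) + δK * (β * Z) := by
    have h := mul_le_mul_of_nonneg_left (add_le_add_right hS2' (β * Z)) (by linarith : (0:ℝ) ≤ 1 + δK)
    have e : (1 + δK) * (τ * Z * (1 + 2 * δK + 4 * δ * s) + β * Z) =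
        τ * Z + β * Z + τ * Z * (2 * δK + 4 * δ * s) + δK * (τ * Z * (1 + 2 * δK + 4 * δ * s)) + δK * (β * Z) := by
      ring
    linarith [h, e.le]
  have hA2 : (δ - δK) * Xoff ≤ δ * (14 * rZ * s ^ 2) := by
    calc (δ - δK) * Xoff ≤ δ * Xoff := mul_le_mul_of_nonneg_right (by linarith) hXoff0
      _ ≤ δ * (14 * rZ * s ^ 2) := mul_le_mul_of_nonneg_left hX' hδ
  have hfin : G2 ≤ 2 * (τ * Z) + β * Z + 24 * ρ * rZ := by linarith [hG, hA1, hA2, hb1, hb2, hb3, hb4]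
  have e : (1 + 24 * ρ) * (2 * τ + β) * Z = 2 * (τ * Z) + β * Z + 24 * ρ * rZ := by rw [hrZ]; ring
  rw [e]; exact hfin

/-- **REMAINDER BOOKKEEPING**: the localised remainder variance is `≤ 64ρ²·(2τ+β)·Z·Z`. [folklore] -/
theorem remainder_algebra_localised {τ β Z S₂ Xoff VR δ δK s : ℝ} (hτ : 0 ≤ τ) (hβ : 0 ≤ β) (hZ : 0 ≤ Z)
    (hδ : 0 ≤ δ) (hδ2 : δ ≤ 1 / 2) (hδK : 0 ≤ δK) (hδKδ : δK ≤ δ) (hs0 : 0 ≤ s) (hs1 : s ≤ 1)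
    (hXoff0 : 0 ≤ Xoff)
    (hS2 : S₂ ≤ τ * ((1 - δK)⁻¹ * (Z - s ^ 4 * Z) + (1 - δ)⁻¹ * (s ^ 4 * Z)))
    (hX : Xoff ≤ 14 * (τ / (1 - δ) + β) * (Z * s ^ 2))
    (hV : VR ≤ (1 - δ)⁻¹ * (2 * δK ^ 2 * (S₂ + β * Z) + 2 * (δ ^ 2 - δK ^ 2) * Xoff +
      2 * (τ * ((1 - δK)⁻¹ * δK ^ 2 * (Z - s ^ 4 * Z) + (1 - δ)⁻¹ * δ ^ 2 * (s ^ 4 * Z)))) * Z) :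
    VR ≤ 64 * (δK + δ * s) ^ 2 * (2 * τ + β) * Z * Z := by
  have haK : (1 - δK)⁻¹ ≤ 1 + 2 * δK := by
    have hx2 : δK ≤ 1 / 2 := hδKδ.trans hδ2
    rw [inv_le_comm₀ (by linarith) (by linarith)]
    have h : (1 + 2 * δK)⁻¹ * (1 + 2 * δK) = 1 := inv_mul_cancel₀ (by linarith)
    nlinarith [inv_nonneg.mpr (by linarith : (0:ℝ) ≤ 1 + 2 * δK)]
  have ha : (1 - δ)⁻¹ ≤ 1 + 2 * δ := by
    rw [inv_le_comm₀ (by linarith) (by linarith)]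
    have h : (1 + 2 * δ)⁻¹ * (1 + 2 * δ) = 1 := inv_mul_cancel₀ (by linarith)
    nlinarith [inv_nonneg.mpr (by linarith : (0:ℝ) ≤ 1 + 2 * δ)]
  have ha2 : (1 - δ)⁻¹ ≤ 2 := by linarith
  have haK2 : (1 - δK)⁻¹ ≤ 2 := by linarith
  have ha0 : 0 ≤ (1 - δ)⁻¹ := inv_nonneg.mpr (by linarith)
  have hs42 : s ^ 4 ≤ s ^ 2 := pow_le_pow_of_le_one hs0 hs1 (by norm_num)
  have hs40 : 0 ≤ s ^ 4 := by positivity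
  have hs41 : s ^ 4 ≤ 1 := pow_le_one₀ hs0 hs1
  have hτZ : 0 ≤ τ * Z := mul_nonneg hτ hZ
  have hβZ : 0 ≤ β * Z := mul_nonneg hβ hZ
  set rZ : ℝ := (2 * τ + β) * Z with hrZ
  have hrZ0 : 0 ≤ rZ := by rw [hrZ]; positivity
  have hτr : τ * Z ≤ rZ := by rw [hrZ]; nlinarith only [hτ, hβ, hZ]
  have hβr : β * Z ≤ rZ := by rw [hrZ]; nlinarith only [hτ, hβ, hZ]
  have hZP : 0 ≤ Z - s ^ 4 * Z := by nlinarith only [hs41, hZ]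
  -- crude bounds on the pieces
  have hS2' : S₂ ≤ 2 * (τ * Z) := by
    have h1 : (1 - δK)⁻¹ * (Z - s ^ 4 * Z) + (1 - δ)⁻¹ * (s ^ 4 * Z) ≤ 2 * Z := by
      have h3 := mul_le_mul_of_nonneg_right haK2 hZP
      have h4 := mul_le_mul_of_nonneg_right ha2 (mul_nonneg hs40 hZ)
      linarith
    have := mul_le_mul_of_nonneg_left h1 hτ
    linarith
  have hX' : Xoff ≤ 14 * rZ * s ^ 2 := by
    have h1 : τ / (1 - δ) + β ≤ 2 * τ + β := by
      rw [div_eq_mul_inv]; nlinarith only [mul_le_mul_of_nonneg_left ha hτ, hτ, hδ, hδ2]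
    have := mul_le_mul_of_nonneg_right (mul_le_mul_of_nonneg_left h1 (by norm_num : (0:ℝ) ≤ 14))
      (by positivity : 0 ≤ Z * s ^ 2)
    rw [hrZ]; linarith
  have hT : τ * ((1 - δK)⁻¹ * δK ^ 2 * (Z - s ^ 4 * Z) + (1 - δ)⁻¹ * δ ^ 2 * (s ^ 4 * Z)) ≤
      2 * δK ^ 2 * (τ * Z) + 2 * (δ ^ 2 * s ^ 2) * (τ * Z) := by
    have h1 : (1 - δK)⁻¹ * δK ^ 2 * (Z - s ^ 4 * Z) ≤ 2 * δK ^ 2 * Z := by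
      have h3 : (1 - δK)⁻¹ * δK ^ 2 * (Z - s ^ 4 * Z) ≤ 2 * δK ^ 2 * (Z - s ^ 4 * Z) :=
        mul_le_mul_of_nonneg_right (mul_le_mul_of_nonneg_right haK2 (sq_nonneg _)) hZP
      have h4 : 2 * δK ^ 2 * (Z - s ^ 4 * Z) ≤ 2 * δK ^ 2 * Z :=
        mul_le_mul_of_nonneg_left (by nlinarith only [hs40, hZ]) (by positivity)
      linarith
    have h2 : (1 - δ)⁻¹ * δ ^ 2 * (s ^ 4 * Z) ≤ 2 * (δ ^ 2 * s ^ 2) * Z := by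
      have h3 : (1 - δ)⁻¹ * δ ^ 2 * (s ^ 4 * Z) ≤ 2 * δ ^ 2 * (s ^ 4 * Z) :=
        mul_le_mul_of_nonneg_right (mul_le_mul_of_nonneg_right ha2 (sq_nonneg _)) (by positivity)
      have h4 : 2 * δ ^ 2 * (s ^ 4 * Z) ≤ 2 * δ ^ 2 * (s ^ 2 * Z) :=
        mul_le_mul_of_nonneg_left (mul_le_mul_of_nonneg_right hs42 hZ) (by positivity)
      linarith
    have := mul_le_mul_of_nonneg_left (add_le_add h1 h2) hτ
    linarith
  -- the bracket is `≤ 32 (δK² + δ² s²) rZ`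
  have hδK2 : δK ^ 2 ≤ δ ^ 2 := pow_le_pow_left₀ hδK hδKδ 2
  have hB1 : 2 * δK ^ 2 * (S₂ + β * Z) ≤ 2 * δK ^ 2 * (2 * (τ * Z) + β * Z) :=
    mul_le_mul_of_nonneg_left (by linarith) (by positivity)
  have hB2 : 2 * (δ ^ 2 - δK ^ 2) * Xoff ≤ 28 * (δ ^ 2 * s ^ 2) * rZ := by
    calc 2 * (δ ^ 2 - δK ^ 2) * Xoff ≤ 2 * δ ^ 2 * Xoff :=
          mul_le_mul_of_nonneg_right (by nlinarith only [sq_nonneg δK]) hXoff0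
      _ ≤ 2 * δ ^ 2 * (14 * rZ * s ^ 2) := mul_le_mul_of_nonneg_left hX' (by positivity)
      _ = 28 * (δ ^ 2 * s ^ 2) * rZ := by ring
  have hB : 2 * δK ^ 2 * (S₂ + β * Z) + 2 * (δ ^ 2 - δK ^ 2) * Xoff +
      2 * (τ * ((1 - δK)⁻¹ * δK ^ 2 * (Z - s ^ 4 * Z) + (1 - δ)⁻¹ * δ ^ 2 * (s ^ 4 * Z))) ≤
      32 * (δK ^ 2 + δ ^ 2 * s ^ 2) * rZ := by
    have p1 := mul_le_mul_of_nonneg_left hτr (by positivity : 0 ≤ δK ^ 2)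
    have p2 := mul_le_mul_of_nonneg_left hβr (by positivity : 0 ≤ δK ^ 2)
    have p3 := mul_le_mul_of_nonneg_left hτr (by positivity : 0 ≤ δ ^ 2 * s ^ 2)
    have p4 : 0 ≤ δK ^ 2 * rZ := by positivity
    linarith [hB1, hB2, hT, p1, p2, p3, p4]
  have hB0 : 0 ≤ 32 * (δK ^ 2 + δ ^ 2 * s ^ 2) * rZ := by positivity
  have hρ2 : δK ^ 2 + δ ^ 2 * s ^ 2 ≤ (δK + δ * s) ^ 2 := by
    nlinarith only [mul_nonneg hδK (mul_nonneg hδ hs0)]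
  have h1 : (1 - δ)⁻¹ * (2 * δK ^ 2 * (S₂ + β * Z) + 2 * (δ ^ 2 - δK ^ 2) * Xoff +
      2 * (τ * ((1 - δK)⁻¹ * δK ^ 2 * (Z - s ^ 4 * Z) + (1 - δ)⁻¹ * δ ^ 2 * (s ^ 4 * Z)))) ≤
      2 * (32 * (δK ^ 2 + δ ^ 2 * s ^ 2) * rZ) :=
    (mul_le_mul_of_nonneg_left hB ha0).trans (mul_le_mul_of_nonneg_right ha2 hB0)
  have h2 := mul_le_mul_of_nonneg_right h1 hZ
  have h3 : 2 * (32 * (δK ^ 2 + δ ^ 2 * s ^ 2) * rZ) * Z ≤ 64 * (δK + δ * s) ^ 2 * (2 * τ + β) * Z * Z := by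
    have := mul_le_mul_of_nonneg_right hρ2 (by positivity : 0 ≤ rZ * Z)
    have e1 : 2 * (32 * (δK ^ 2 + δ ^ 2 * s ^ 2) * rZ) * Z = 64 * ((δK ^ 2 + δ ^ 2 * s ^ 2) * (rZ * Z)) := by ring
    have e2 : 64 * (δK + δ * s) ^ 2 * (2 * τ + β) * Z * Z = 64 * ((δK + δ * s) ^ 2 * (rZ * Z)) := by
      rw [hrZ]; ring
    rw [e1, e2]; linarith only [this]
  linarith [hV, h2, h3]

/-- **CEILING BOOKKEEPING**: if `X ≤ (1+t)G + (1+t⁻¹)V` for all `t > 0` with `0 ≤ G ≤ (1+24ρ)R`,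
`0 ≤ V ≤ 64ρ²R`, `0 ≤ ρ ≤ 1`, then `X ≤ (1 + 168ρ)R`. [folklore] -/
theorem ceiling_algebra_localised {X G V R ρ : ℝ} (hR : 0 ≤ R) (hρ : 0 ≤ ρ) (hρ1 : ρ ≤ 1)
    (hG0 : 0 ≤ G) (hV0 : 0 ≤ V) (hG : G ≤ (1 + 24 * ρ) * R) (hV : V ≤ 64 * ρ ^ 2 * R)
    (h : ∀ t : ℝ, 0 < t → X ≤ (1 + t) * G + (1 + t⁻¹) * V) : X ≤ (1 + 168 * ρ) * R := by
  -- `X − G − V ≤ 2√(GV)` by the AM–GM optimisation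
  have hamgm : ∀ s : ℝ, 0 < s → X - G - V ≤ (s * (2 * G) + (2 * V) / s) / 2 := by
    intro s hs
    have h1 := h s hs
    have e : (1 + s) * G + (1 + s⁻¹) * V = G + V + (s * (2 * G) + (2 * V) / s) / 2 := by
      field_simp; ring
    linarith [h1, e.le]
  have hsq := le_sqrt_mul_of_forall_amgm (by positivity) (by positivity) hamgm
  -- `√(2G · 2V) ≤ 80 ρ R`
  have hGV : 2 * G * (2 * V) ≤ (80 * ρ * R) ^ 2 := by
    have h1 : G * V ≤ ((1 + 24 * ρ) * R) * (64 * ρ ^ 2 * R) := mul_le_mul hG hV hV0 (by positivity)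
    have h2 : (1 + 24 * ρ) * (64 * ρ ^ 2) ≤ 1600 * ρ ^ 2 := by nlinarith [sq_nonneg ρ]
    have h3 := mul_le_mul_of_nonneg_right h2 (mul_nonneg hR hR)
    nlinarith [h1, h3]
  have hsqrt : Real.sqrt (2 * G * (2 * V)) ≤ 80 * ρ * R := by
    calc Real.sqrt (2 * G * (2 * V)) ≤ Real.sqrt ((80 * ρ * R) ^ 2) := Real.sqrt_le_sqrt hGV
      _ = 80 * ρ * R := Real.sqrt_sq (by positivity)
  have hρ2 : ρ ^ 2 ≤ ρ := by nlinarith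
  have h64 := mul_le_mul_of_nonneg_right hρ2 hR
  linarith [hsq, hsqrt, hG, hV, h64]

end Summit.QuantumFields.YangMills.Theorems.SandwichVariancePinching

end
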